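import Summits.CriticalPhenomena.Ising3DConformalLimit.Theses.UnitLightCone

/-!
# `UnitSpeedTwoPoint` (crux stmt-CriticalPhenomena-17167), line `yukawa_subordination`, stub A
# `stub_laplaceMeasurePowerLaw`: the guard `1/2 ≤ Δ` is SHARP (negative-side support, refuter cdisprove seat)

Stub A of `Cruxes/UnitSpeedTwoPoint/Lines/yukawa_subordination.lean` asks, for `Δ ≥ 1/2`, for an s-finite measure
`ν` on `[0, ∞)` with `∫ e^{-mr} dν(m) = r^{1-2Δ}` (`r > 0`).  Here, sorry-free:

* `laplaceMeasurePowerLaw_false_below_half` — for every `Δ < 1/2` NO positive measure carried by `[0,∞)` does this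
  (Laplace transforms of positive measures are non-increasing in `r`; `r^{1-2Δ}` is strictly increasing);
* `stub_laplaceMeasurePowerLaw_false_without_half` — so the registered signature with its guard deleted is false
  (witness `Δ = 0`).

Moral: the guard is the line's only Δ-sensitive input and it is exactly the tree's infrared-bound window
`1/2 ≤ Δ` (`twoPointKernelOfLimit_proof`); at the endpoint `Δ = 1/2` the witness degenerates to `ν = δ₀`
(case split).  This file does NOT refute the crux or the stub.
-/

noncomputable section

namespace Summit.CriticalPhenomena.Ising3DConformalLimit.Theorems.UnitSpeedTwoPoint.Negative

open MeasureTheory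

/-- **Stub A below the window is false**: for `Δ < 1/2` NO positive measure on `[0, ∞)` has Laplace transform
`r^{1-2Δ}` — Laplace transforms of positive measures are non-increasing in `r`, `r^{1-2Δ}` is strictly increasing.
(This is the only Δ-sensitive input of the line; `Δ ≥ 1/2` is supplied by the tree's infrared-bound window.)
[folklore] -/
theorem laplaceMeasurePowerLaw_false_below_half {Δ : ℝ} (hΔ : Δ < 1 / 2) :
    ¬ ∃ ν : Measure ℝ, ν (Set.Iio 0) = 0 ∧ ∀ r : ℝ, 0 < r →
        Integrable (fun m : ℝ => Real.exp (-(m * r))) ν ∧ ∫ m, Real.exp (-(m * r)) ∂ν = r ^ (1 - 2 * Δ) := by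
  rintro ⟨ν, hν0, hν⟩
  obtain ⟨hi1, h1⟩ := hν 1 one_pos
  obtain ⟨hi2, h2⟩ := hν 2 two_pos
  have hae : ∀ᵐ m ∂ν, 0 ≤ m := by
    have h0 := measure_eq_zero_iff_ae_notMem.1 hν0
    filter_upwards [h0] with m hm
    simpa using hm
  have hmono : ∫ m, Real.exp (-(m * 2)) ∂ν ≤ ∫ m, Real.exp (-(m * 1)) ∂ν :=
    integral_mono_ae hi2 hi1 (by
      filter_upwards [hae] with m hm
      exact Real.exp_le_exp.2 (by nlinarith))
  rw [h1, h2, Real.one_rpow] at hmono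
  have : (1:ℝ) < (2:ℝ) ^ (1 - 2 * Δ) := Real.one_lt_rpow (by norm_num) (by linarith)
  linarith

/-- Hence the registered signature of `stub_laplaceMeasurePowerLaw` with its guard `1/2 ≤ Δ` deleted is false
(witness `Δ = 0`): the guard is load-bearing. [folklore] -/
theorem stub_laplaceMeasurePowerLaw_false_without_half :
    ¬ ∀ Δ : ℝ, ∃ ν : MeasureTheory.Measure ℝ, MeasureTheory.SFinite ν ∧ ν (Set.Iio 0) = 0 ∧
        ∀ r : ℝ, 0 < r →
          MeasureTheory.Integrable (fun m : ℝ => Real.exp (-(m * r))) ν ∧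
            ∫ m, Real.exp (-(m * r)) ∂ν = r ^ (1 - 2 * Δ) := by
  intro h
  obtain ⟨ν, -, hν0, hν⟩ := h 0
  exact laplaceMeasurePowerLaw_false_below_half (by norm_num : (0:ℝ) < 1 / 2) ⟨ν, hν0, hν⟩


end Summit.CriticalPhenomena.Ising3DConformalLimit.Theorems.UnitSpeedTwoPoint.Negative

end
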